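import Mathlib.Analysis.CStarAlgebra.Matrix
import Mathlib.Analysis.Matrix.HermitianFunctionalCalculus
import Mathlib.Analysis.SpecialFunctions.Arcosh
import Literature.MathematicalPhysics.QuantumLattice.GrassmannIntegralProofs
import HarnessLib

/-!
# Locality of Neuberger's overlap operator under the admissibility bound (Hernández–Jansen–Lüscher 1999)

Topic `Literature/MathematicalPhysics/QuantumLattice`; namespace
`Literature.MathematicalPhysics.QuantumLattice`.  Cite item `wi-18705` of route
`QuantumFields/QCD/OverlapPositivityTransfer` (cruxes OverlapLatticeGap / OverlapContinuumLimit):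
the named fact `HJLLocality` — the Hermitian Wilson kernel at the overlap projection point has a
uniform spectral gap, and the inverse square root `(A†A)^{-1/2}` (hence Neuberger's operator) has an
exponentially decaying kernel, for link fields with `‖1 − U(p)‖ ≤ ε`, `ε < 1/30`.

## The printed results [HernandezJansenLuscher1999] (arXiv:hep-lat/9808010; equation numbers of the paper)

Setting (App. A): four-dimensional hypercubic lattice of spacing `a` "and variable size. If the
lattice is finite we impose periodic boundary conditions"; unitary link matrices `U(x,μ)`;
covariant differences `∇_μψ(x) = a⁻¹[U(x,μ)ψ(x+aμ̂) − ψ(x)]`, `∇*_μψ(x) = a⁻¹[ψ(x) −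
U(x−aμ̂,μ)⁻¹ψ(x−aμ̂)]`; Hermitian `γ_μ`, `γ₅ = γ₀γ₁γ₂γ₃`.  Neuberger's operator (1.2)–(1.3):
`D = a⁻¹{1 − A(A†A)^{-1/2}}`, `A = 1 + s − aD_w`, `D_w = ½{γ_μ(∇*_μ + ∇_μ) − a∇*_μ∇_μ}`, `|s| < 1`.
"An inequality between operators stands for the corresponding inequality between the expectation
values of the operators in arbitrary normalizable states" (footnote to (2.1)).

* (2.1), (2.5), (2.6): if `u ≤ A†A ≤ v` for constants `0 < u < v`, put `cosh θ = (v+u)/(v−u)`,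
  `θ > 0`, `t = e^{−θ}`, `κ = {4t/(v−u)}^{1/2}`; then `(A†A)^{-1/2} = κ Σ_k t^k P_k(z)`,
  `z = (v+u−2A†A)/(v−u)`, `‖P_k(z)‖ ≤ 1` (Legendre expansion, norm convergent).
* (2.7)–(2.12) (§2.2, "the lattice is here taken to be infinitely extended"): with `G(x,y)` the
  kernel of `(A†A)^{-1/2}`, `(A†A)^{-1/2}ψ(x) = a⁴Σ_y G(x,y)ψ(y)`, "a matrix acting on the Dirac and
  colour indices", and the taxi-driver distance `‖x−y‖₁ = Σ_μ|x_μ − y_μ|` (2.10):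
  `G_k(x,y) = 0` for all `k < ‖x−y‖₁/2a` (2.11), hence
  `a⁴‖G(x,y)‖ ≤ κ/(1−t) · exp{−θ‖x−y‖₁/2a}` (2.12), the norm being "the matrix norm in Dirac and
  colour space"; "the localization range `2a/θ` and the proportionality constant in eq. (2.12)
  only depend on the bounds `u` and `v`".
* (2.14): `‖A‖ = ‖A†‖ ≤ 8` for `|s| < 1` and every gauge field.
* (2.15)–(2.16) (§2.3, proof in App. C): if `‖1 − U(p)‖ ≤ ε` for all plaquettes `p` ("`U(p)` the
  product of the gauge field variables around `p` and the norm the matrix norm in colour space"),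
  then for `s = 0`:  `A†A ≥ 1 − 30ε` (2.16).  "`A†A` is hence uniformly bounded from below by a
  positive constant if `ε` is sufficiently small. In particular, the locality of `D` is guaranteed
  under these conditions"; §2.5 / §4: for `ε` "strictly less than `1/30` … Neuberger's operator is
  local … the localization range is uniformly bounded from above by a constant depending on `ε`
  only".  Lüscher calls such fields *admissible* [Luscher1999AbelianChiral, §2.1 (2.9)] and records
  that "the relevant results of [HJL] in fact apply for admissible fields only and if `ε` is such
  that `|e_α| ε < 1/30`" [Luscher1999AbelianChiral, §2.3; App. B, `D = 1 − A(A†A)^{-1/2}`,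
  `A = 1 − D_w`].

## How it is stated here

Lattice units `a = 1`; the tree's torus `TorusSite 4 L = (ℤ/Lℤ)⁴`, `L ≥ 1`, fermion index
`TorusSite 4 L × Fin N × Fin 4` (site, colour, spin), gauge field `U : GaugeConfig 4 L G` read through
a unitary representation `ρ : G →* Matrix (Fin N) (Fin N) ℂ` (the statements only involve the
unitary matrices `ρ(U(x,μ))`, HJL's `U(x,μ)`).  The tree's Wilson operator
`wilsonDirac ρ U m 1` (`GrassmannIntegral.lean`, `r = 1`) is `D_w + m` in HJL's conventions — same
link orientation as App. A (`ρ(U(x,μ))` on the hop `ψ(x+μ̂) → ψ(x)`), same chiral-basis-free data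
(Hermitian `γ_μ` with `{γ_μ,γ_ν} = 2δ`, `γ₅ = γ₀γ₁γ₂γ₃`) — so

  `A = 1 + s − D_w = −(wilsonDirac ρ U (−(1+s)) 1)`,  `A†A = D_Wᴴ D_W`,  `s = 0 ↔ m = −1`,

the overlap projection point `m₀ = 1` used by the route (`wilsonDirac U (−1) 1`).  Operator
inequalities are written as inequalities of quadratic forms `Σ_i ‖(Mψ)_i‖²` versus `Σ_i ‖ψ_i‖²`
(HJL's footnote); "the matrix norm in colour space / in Dirac and colour space" is Mathlib's `ℓ²`
operator norm on matrices (`open scoped Matrix.Norms.L2Operator`); `(A†A)^{-1/2}` is the continuous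
functional calculus `cfc (fun λ => (√λ)⁻¹) (D_Wᴴ D_W)` of the Hermitian matrix `D_Wᴴ D_W` (Mathlib's
matrix instance, the one the route's `cfc Real.sign` uses); the kernel `G(x,y)` is the
`(colour × spin)`-block `siteBlock G x y`; the taxi-driver distance on the periodic lattice is
`torusTaxiDist` (coordinate differences "taken modulo `L` so as to minimize the distance", HJL §3.1).

`HJLLocality ρ` is ONE named fact, the conjunction of (2.16) and of the Legendre locality bound
(2.12); it is not proved here (App. C is a page of covariant-difference algebra on the
`4NL⁴`-dimensional fermion space; (2.12) needs the Legendre generating function as an operator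
identity and `|P_k| ≤ 1` on `[−1,1]`, neither in Mathlib).  PROVED here: the norm bound (2.14) —
`wilsonDirac_eq_sub_sum_wilsonHop` (`D_W(m) = (m+4)·1 − Σ_μ W_μ` with the four hopping matrices
`W_μ = F_μ ⊗ ½(1−γ_μ) + F_μᴴ ⊗ ½(1+γ_μ)`, `F_μ` the unitary `U`-twisted shift),
`conjTranspose_mul_wilsonHop` (`W_μᴴW_μ = 1`), hence `l2_opNorm_wilsonDirac_le`
(`‖D_W(m)‖ ≤ |m+4| + 4`), `l2_opNorm_wilsonDirac_le_eight` ((2.14) as printed, `m ∈ (−2,0)`) and the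
quadratic-form version `sum_norm_sq_wilsonDirac_mulVec_le` (`A†A ≤ 64`); the closed forms
`hjlT_eq` (`t = (√v−√u)/(√v+√u)`) and `hjlKappa_div_one_sub_hjlT` (`κ/(1−t) = u^{−1/2}`); and, FROM the
named fact, the packaged statement the route consumes, `HJLLocality.locality_of_admissible` — for an
admissible field with `ε < 1/30` the kernel of `(A†A)^{-1/2}` at `s = 0` obeys (2.12) with
`u = 1 − 30ε`, `v = 64` on every periodic lattice — and its closed form
`HJLLocality.locality_of_admissible_closedForm`:
`‖G(x,y)‖ ≤ (1−30ε)^{−1/2} ((8 − √(1−30ε))/(8 + √(1−30ε)))^{‖x−y‖₁/2}`.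

Scope caveats. (i) (2.12) is printed for the infinite lattice `ℤ⁴`; the conjunct below is its
periodic-torus transcription (HJL App. A: finite lattices are periodic; §3.1 uses exactly this
periodic taxi-driver distance), whose printed proof applies verbatim ((2.11) only uses that `A`
couples nearest neighbours, true on `(ℤ/Lℤ)⁴` with the periodic distance).  (ii) Nothing is
claimed about `D` itself beyond `G`: HJL's "in view of eq. (1.2) it suffices to establish the
locality of the inverse square root of `A†A`" (`D = 1 − A·G`, `A` strictly local) is left to users.
(iii) Differentiability in the gauge field (App. B) and the near-zero-mode discussion (§2.4) are
not vendored.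

## References

* P. Hernández, K. Jansen, M. Lüscher, *Locality properties of Neuberger's lattice Dirac
  operator*, Nucl. Phys. B 552 (1999) 363–378, arXiv:hep-lat/9808010 (read: arXiv TeX source,
  §§1–2, App. A–C). [HernandezJansenLuscher1999]
* M. Lüscher, *Abelian chiral gauge theories on the lattice with exact gauge invariance*, Nucl.
  Phys. B 549 (1999) 295–334, arXiv:hep-lat/9811032, §2.1 (2.9), §2.3, App. B. [Luscher1999AbelianChiral]
* H. Neuberger, *Exactly massless quarks on the lattice*, Phys. Lett. B 417 (1998) 141. [Neuberger1998]
-/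

noncomputable section

open Matrix Finset
open scoped Kronecker
open Literature.Probability.LatticeModels (TorusSite)
open Literature.MathematicalPhysics.QuantumFieldTheory

namespace Literature.MathematicalPhysics.QuantumLattice

/-! ### Taxi-driver distance on the periodic lattice, kernel blocks, admissibility -/

/-- The periodic **taxi-driver distance** `‖x − y‖₁ = Σ_μ |x_μ − y_μ|` on `(ℤ/Lℤ)^d`, each
coordinate difference "taken modulo `L` so as to minimize the distance" (`min (k, L − k)` for the
representative `k ∈ [0, L)` of `x_μ − y_μ`).  Junk for `L = 0`.
[cite: HernandezJansenLuscher1999, (2.10) and §3.1] -/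
def torusTaxiDist {d L : ℕ} (x y : TorusSite d L) : ℕ :=
  ∑ i, min (x i - y i).val (L - (x i - y i).val)

/-- `‖x − x‖₁ = 0`. [folklore] -/
@[simp] theorem torusTaxiDist_self {d L : ℕ} (x : TorusSite d L) : torusTaxiDist x x = 0 := by
  simp [torusTaxiDist]

/-- The taxi-driver distance is symmetric. [folklore] -/
theorem torusTaxiDist_comm {d L : ℕ} [NeZero L] (x y : TorusSite d L) :
    torusTaxiDist x y = torusTaxiDist y x := by
  unfold torusTaxiDist
  refine Finset.sum_congr rfl fun i _ => ?_
  have h : y i - x i = -(x i - y i) := by ring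
  rw [h, ZMod.neg_val]
  split_ifs with h0
  · rw [h0, ZMod.val_zero]
  · have hlt : (x i - y i).val < L := ZMod.val_lt _
    have hpos : 0 < (x i - y i).val := by
      rw [Nat.pos_iff_ne_zero]; exact fun h' => h0 ((ZMod.val_eq_zero _).mp h')
    omega

variable {L N : ℕ} {G : Type*} [Group G]

/-- The **kernel block** `M(x,y)` of an operator on lattice fermions: "a matrix acting on the Dirac
and colour indices of the fermion field at the point `y`", `(Mψ)(x) = Σ_y M(x,y)ψ(y)` (lattice
units). [cite: HernandezJansenLuscher1999, (1.4) and (2.7)] -/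
def siteBlock (M : Matrix (TorusSite 4 L × Fin N × Fin 4) (TorusSite 4 L × Fin N × Fin 4) ℂ)
    (x y : TorusSite 4 L) : Matrix (Fin N × Fin 4) (Fin N × Fin 4) ℂ :=
  M.submatrix (Prod.mk x) (Prod.mk y)

omit [Group G] in
/-- Entries of the kernel block. [folklore] -/
@[simp] theorem siteBlock_apply
    (M : Matrix (TorusSite 4 L × Fin N × Fin 4) (TorusSite 4 L × Fin N × Fin 4) ℂ)
    (x y : TorusSite 4 L) (i j : Fin N × Fin 4) : siteBlock M x y i j = M (x, i) (y, j) := rfl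

open scoped Matrix.Norms.L2Operator in
/-- **Admissibility in norm form** (HJL (2.15); Lüscher's "admissible" fields): every plaquette
matrix is `ε`-close to `1` in the operator norm on colour space, `‖1 − ρ(U(p))‖ ≤ ε` for all
plaquettes `p` (the bound does not depend on the orientation / base point of `p`, `ρ(U)` being
unitary). [cite: HernandezJansenLuscher1999, (2.15)] -/
def IsNormAdmissible {d : ℕ} (ρ : G →* Matrix (Fin N) (Fin N) ℂ) (U : GaugeConfig d L G) (ε : ℝ) :
    Prop :=
  ∀ p : Plaquette d L,
    ‖(1 : Matrix (Fin N) (Fin N) ℂ) - ρ (plaquetteHolonomy U p.1 p.2.1.1 p.2.1.2)‖ ≤ ε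

/-! ### The constants of the Legendre expansion -/

/-- HJL's decay exponent `θ > 0`, `cosh θ = (v + u)/(v − u)` for spectral bounds `0 < u < v` of
`A†A`. [cite: HernandezJansenLuscher1999, (2.5)] -/
def hjlTheta (u v : ℝ) : ℝ := Real.arcosh ((v + u) / (v - u))

/-- HJL's expansion parameter `t = e^{−θ}`. [cite: HernandezJansenLuscher1999, (2.5)–(2.6)] -/
def hjlT (u v : ℝ) : ℝ := Real.exp (-hjlTheta u v)

/-- HJL's normalisation `κ = {4t/(v − u)}^{1/2}`. [cite: HernandezJansenLuscher1999, (2.6)] -/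
def hjlKappa (u v : ℝ) : ℝ := Real.sqrt (4 * hjlT u v / (v - u))

/-- **Closed form of `t`**: for `0 < u < v`, `t = e^{−θ} = (√v − √u)/(√v + √u)`
(from `cosh θ = (v+u)/(v−u)`: `e^{−θ} = c − √(c² − 1)`, `c² − 1 = 4uv/(v−u)²`). [folklore] -/
theorem hjlT_eq {u v : ℝ} (hu : 0 < u) (huv : u < v) :
    hjlT u v = (Real.sqrt v - Real.sqrt u) / (Real.sqrt v + Real.sqrt u) := by
  set a := Real.sqrt u with ha
  set b := Real.sqrt v with hb
  have ha0 : 0 < a := Real.sqrt_pos.mpr hu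
  have hab : a < b := Real.sqrt_lt_sqrt hu.le huv
  have hb0 : 0 < b := ha0.trans hab
  have hu' : u = a ^ 2 := (Real.sq_sqrt hu.le).symm
  have hv' : v = b ^ 2 := (Real.sq_sqrt (hu.le.trans huv.le)).symm
  have hvu : 0 < b ^ 2 - a ^ 2 := by nlinarith
  set c := (v + u) / (v - u) with hc
  have hc1 : 1 ≤ c := by
    rw [hc, le_div_iff₀ (by linarith), one_mul]; linarith
  have hroot : Real.sqrt (c ^ 2 - 1) = 2 * a * b / (b ^ 2 - a ^ 2) := by
    have : c ^ 2 - 1 = (2 * a * b / (b ^ 2 - a ^ 2)) ^ 2 := by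
      rw [hc, hu', hv']; field_simp; ring
    rw [this, Real.sqrt_sq (by positivity)]
  rw [hjlT, hjlTheta, Real.exp_neg, Real.exp_arcosh hc1, Real.add_sqrt_self_sq_sub_one_inv hc1,
    hroot, hc, hu', hv']
  have hba : b - a ≠ 0 := by linarith
  have hba' : b + a ≠ 0 := by linarith
  field_simp
  ring

/-- **Closed form of the prefactor**: `κ/(1 − t) = u^{−1/2}` for `0 < u < v`
(`4t/(v−u) = 4/(√v+√u)²`, `1 − t = 2√u/(√v+√u)`). [folklore] -/
theorem hjlKappa_div_one_sub_hjlT {u v : ℝ} (hu : 0 < u) (huv : u < v) :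
    hjlKappa u v / (1 - hjlT u v) = (Real.sqrt u)⁻¹ := by
  have ht := hjlT_eq hu huv
  set a := Real.sqrt u with ha
  set b := Real.sqrt v with hb
  have ha0 : 0 < a := Real.sqrt_pos.mpr hu
  have hab : a < b := Real.sqrt_lt_sqrt hu.le huv
  have hb0 : 0 < b := ha0.trans hab
  have hu' : u = a ^ 2 := (Real.sq_sqrt hu.le).symm
  have hv' : v = b ^ 2 := (Real.sq_sqrt (hu.le.trans huv.le)).symm
  have hba : b - a ≠ 0 := by linarith
  have hba' : b + a ≠ 0 := by linarith
  have hsq : b ^ 2 - a ^ 2 ≠ 0 := by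
    rw [sq_sub_sq]; exact mul_ne_zero hba' hba
  have hk : hjlKappa u v = 2 / (b + a) := by
    rw [hjlKappa, ht, hu', hv']
    have : 4 * ((b - a) / (b + a)) / (b ^ 2 - a ^ 2) = (2 / (b + a)) ^ 2 := by
      field_simp; ring
    rw [this, Real.sqrt_sq (by positivity)]
  have h2 : 1 - (b - a) / (b + a) = 2 * a / (b + a) := by
    field_simp
    ring
  rw [hk, ht, h2, div_div_div_cancel_right₀ hba', ← div_div, div_self (two_ne_zero' ℝ), one_div]

/-- The exponential factor as a power of `t`: `exp(−θ d/2) = t^{d/2}`. [folklore] -/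
theorem exp_neg_hjlTheta_mul (u v d : ℝ) :
    Real.exp (-(hjlTheta u v * d / 2)) = hjlT u v ^ (d / 2) := by
  rw [hjlT, ← Real.exp_mul]
  congr 1
  ring

/-! ### The named fact -/

open scoped Matrix.Norms.L2Operator in
/-- **Hernández–Jansen–Lüscher 1999 (locality of Neuberger's operator), as one named fact** for a
unitary representation `ρ` of the link variables, on every periodic lattice `(ℤ/Lℤ)⁴`, `L ≥ 1`,
lattice units, `A = −wilsonDirac ρ U (−(1+s)) 1`:
(1) [(2.16), App. C] if `‖1 − ρ(U(p))‖ ≤ ε` for all plaquettes then at `s = 0`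
`A†A ≥ 1 − 30ε`, i.e. `Σ_i‖(D_W(−1)ψ)_i‖² ≥ (1 − 30ε) Σ_i‖ψ_i‖²` for every `ψ`;
(2) [(2.12), torus transcription, see the module docstring] if `u ≤ A†A ≤ v` as quadratic forms
with `0 < u < v` (`|s| < 1`, i.e. mass parameter `m = −(1+s) ∈ (−2, 0)`), then the kernel of
`(A†A)^{-1/2}` satisfies `‖G(x,y)‖ ≤ κ/(1−t) · exp(−θ‖x−y‖₁/2)` in the operator norm on Dirac and
colour space, with `cosh θ = (v+u)/(v−u)`, `t = e^{−θ}`, `κ = (4t/(v−u))^{1/2}`.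
[cite: HernandezJansenLuscher1999, (2.16) and (2.12)] -/
def HJLLocality (ρ : G →* Matrix (Fin N) (Fin N) ℂ) : Prop :=
  (∀ (_ : ∀ g, ρ g ∈ Matrix.unitaryGroup (Fin N) ℂ) {L : ℕ} [NeZero L] (U : GaugeConfig 4 L G)
      (ε : ℝ), IsNormAdmissible ρ U ε →
      ∀ ψ : TorusSite 4 L × Fin N × Fin 4 → ℂ,
        (1 - 30 * ε) * ∑ i, ‖ψ i‖ ^ 2 ≤ ∑ i, ‖(wilsonDirac ρ U (-1) 1 *ᵥ ψ) i‖ ^ 2) ∧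
  (∀ (_ : ∀ g, ρ g ∈ Matrix.unitaryGroup (Fin N) ℂ) {L : ℕ} [NeZero L] (U : GaugeConfig 4 L G)
      (m u v : ℝ), -2 < m → m < 0 → 0 < u → u < v →
      (∀ ψ : TorusSite 4 L × Fin N × Fin 4 → ℂ,
        u * ∑ i, ‖ψ i‖ ^ 2 ≤ ∑ i, ‖(wilsonDirac ρ U m 1 *ᵥ ψ) i‖ ^ 2) →
      (∀ ψ : TorusSite 4 L × Fin N × Fin 4 → ℂ,
        ∑ i, ‖(wilsonDirac ρ U m 1 *ᵥ ψ) i‖ ^ 2 ≤ v * ∑ i, ‖ψ i‖ ^ 2) →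
      ∀ x y : TorusSite 4 L,
        ‖siteBlock (cfc (fun s : ℝ => (Real.sqrt s)⁻¹)
            ((wilsonDirac ρ U m 1)ᴴ * wilsonDirac ρ U m 1)) x y‖ ≤
          hjlKappa u v / (1 - hjlT u v) * Real.exp (-(hjlTheta u v * torusTaxiDist x y / 2)))


/-! ### The norm bound (2.14), proved

`‖A‖ ≤ 8`: writing `wilsonDirac ρ U m 1 = (m + 4)·1 − Σ_μ W_μ` with the four hopping matrices
`W_μ = F_μ ⊗ ½(1 − γ_μ) + F_μᴴ ⊗ ½(1 + γ_μ)` (`F_μ` the `U`-twisted forward shift on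
site ⊗ colour, unitary), each `W_μ` satisfies `W_μᴴ W_μ = 1`, hence `‖W_μ‖ ≤ 1` and
`‖wilsonDirac ρ U m 1‖ ≤ |m + 4| + 4` ("using the triangle inequality", HJL after (2.13)). -/

section NormBound

variable (ρ : G →* Matrix (Fin N) (Fin N) ℂ)

/-- The chiral hopping projector `P⁻_μ = ½(1 − γ_μ)`. [cite: HernandezJansenLuscher1999, (2.13)] -/
def chiralProjMinus (μ : Fin 4) : Matrix (Fin 4) (Fin 4) ℂ := (2 : ℂ)⁻¹ • (1 - euclideanGamma μ)

/-- The chiral hopping projector `P⁺_μ = ½(1 + γ_μ)`. [cite: HernandezJansenLuscher1999, (2.13)] -/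
def chiralProjPlus (μ : Fin 4) : Matrix (Fin 4) (Fin 4) ℂ := (2 : ℂ)⁻¹ • (1 + euclideanGamma μ)

/-- `P⁻_μ` is Hermitian. [folklore] -/
theorem chiralProjMinus_conjTranspose (μ : Fin 4) : (chiralProjMinus μ)ᴴ = chiralProjMinus μ := by
  rw [chiralProjMinus, conjTranspose_smul, conjTranspose_sub, conjTranspose_one,
    (euclideanGamma_isHermitian μ).eq]
  simp

/-- `P⁺_μ` is Hermitian. [folklore] -/
theorem chiralProjPlus_conjTranspose (μ : Fin 4) : (chiralProjPlus μ)ᴴ = chiralProjPlus μ := by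
  rw [chiralProjPlus, conjTranspose_smul, conjTranspose_add, conjTranspose_one,
    (euclideanGamma_isHermitian μ).eq]
  simp

/-- `P⁻_μ P⁻_μ = P⁻_μ`. [folklore] -/
theorem chiralProjMinus_mul_self (μ : Fin 4) :
    chiralProjMinus μ * chiralProjMinus μ = chiralProjMinus μ := by
  have hγ := euclideanGamma_mul_self μ
  have h2 : (1 - euclideanGamma μ) * (1 - euclideanGamma μ) = (2 : ℂ) • (1 - euclideanGamma μ) := by
    rw [sub_mul, mul_sub, mul_sub, one_mul, one_mul, mul_one, hγ, two_smul]; abel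
  rw [chiralProjMinus, Matrix.smul_mul, Matrix.mul_smul, smul_smul, h2, smul_smul]
  norm_num

/-- `P⁺_μ P⁺_μ = P⁺_μ`. [folklore] -/
theorem chiralProjPlus_mul_self (μ : Fin 4) :
    chiralProjPlus μ * chiralProjPlus μ = chiralProjPlus μ := by
  have hγ := euclideanGamma_mul_self μ
  have h2 : (1 + euclideanGamma μ) * (1 + euclideanGamma μ) = (2 : ℂ) • (1 + euclideanGamma μ) := by
    rw [add_mul, mul_add, mul_add, one_mul, one_mul, mul_one, hγ, two_smul]; abel
  rw [chiralProjPlus, Matrix.smul_mul, Matrix.mul_smul, smul_smul, h2, smul_smul]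
  norm_num

/-- `P⁻_μ P⁺_μ = 0`. [folklore] -/
theorem chiralProjMinus_mul_chiralProjPlus (μ : Fin 4) :
    chiralProjMinus μ * chiralProjPlus μ = 0 := by
  have hγ := euclideanGamma_mul_self μ
  have h2 : (1 - euclideanGamma μ) * (1 + euclideanGamma μ) = 0 := by
    rw [sub_mul, mul_add, mul_add, one_mul, one_mul, mul_one, hγ]; abel
  rw [chiralProjMinus, chiralProjPlus, Matrix.smul_mul, Matrix.mul_smul, smul_smul, h2, smul_zero]

/-- `P⁺_μ P⁻_μ = 0`. [folklore] -/
theorem chiralProjPlus_mul_chiralProjMinus (μ : Fin 4) :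
    chiralProjPlus μ * chiralProjMinus μ = 0 := by
  have hγ := euclideanGamma_mul_self μ
  have h2 : (1 + euclideanGamma μ) * (1 - euclideanGamma μ) = 0 := by
    rw [add_mul, mul_sub, mul_sub, one_mul, one_mul, mul_one, hγ]; abel
  rw [chiralProjMinus, chiralProjPlus, Matrix.smul_mul, Matrix.mul_smul, smul_smul, h2, smul_zero]

/-- `P⁻_μ + P⁺_μ = 1`. [folklore] -/
theorem chiralProjMinus_add_chiralProjPlus (μ : Fin 4) :
    chiralProjMinus μ + chiralProjPlus μ = 1 := by
  rw [chiralProjMinus, chiralProjPlus, ← smul_add,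
    show (1 - euclideanGamma μ) + (1 + euclideanGamma μ) =
        (2 : ℂ) • (1 : Matrix (Fin 4) (Fin 4) ℂ) by rw [two_smul]; abel,
    smul_smul]
  norm_num

omit [Group G] in
/-- `star` moves through `if … then a else 0`. [folklore] -/
theorem star_ite_zero (c : Prop) [Decidable c] (a : ℂ) :
    star (if c then a else 0) = if c then star a else 0 := by
  split_ifs <;> simp

/-- The `U`-twisted forward shift on site ⊗ colour space in direction `μ`,
`(F_μψ)(x) = ρ(U(x,μ)) ψ(x + μ̂)` (kernel `F_μ((x,a),(y,b)) = δ_{y,x+μ̂} ρ(U(x,μ))_{ab}`), i.e.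
`1 + ∇_μ` in HJL's notation. [cite: HernandezJansenLuscher1999, (A.1)] -/
def linkHop (U : GaugeConfig 4 L G) (μ : Fin 4) :
    Matrix (TorusSite 4 L × Fin N) (TorusSite 4 L × Fin N) ℂ :=
  Matrix.of fun p q => if q.1 = Site.shift p.1 μ then ρ (U (p.1, μ)) p.2 q.2 else 0

omit [Group G] in
/-- `x = z + μ̂ ↔ z = x − μ̂` on the torus. [folklore] -/
theorem eq_shift_iff {d : ℕ} (x z : TorusSite d L) (μ : Fin d) :
    x = Site.shift z μ ↔ z = x - Pi.single μ 1 := by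
  rw [Site.shift, eq_sub_iff_add_eq]
  exact eq_comm

variable [NeZero L]

/-- `F_μᴴ F_μ = 1`. [folklore] -/
theorem conjTranspose_mul_linkHop (hρ : ∀ g, ρ g ∈ Matrix.unitaryGroup (Fin N) ℂ)
    (U : GaugeConfig 4 L G) (μ : Fin 4) : (linkHop ρ U μ)ᴴ * linkHop ρ U μ = 1 := by
  ext p q
  rw [Matrix.mul_apply, Fintype.sum_prod_type]
  simp only [conjTranspose_apply, linkHop, Matrix.of_apply, eq_shift_iff]
  simp only [star_ite_zero, ite_zero_mul_ite_zero]
  simp_rw [Finset.sum_ite_irrel, Finset.sum_const_zero]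
  have hunit : ∀ z : TorusSite 4 L, ∑ c : Fin N, star (ρ (U (z, μ)) c p.2) * ρ (U (z, μ)) c q.2 =
      (1 : Matrix (Fin N) (Fin N) ℂ) p.2 q.2 := by
    intro z
    rw [← Matrix.mem_unitaryGroup_iff'.mp (hρ (U (z, μ))), Matrix.mul_apply]
    rfl
  by_cases hpq : p.1 = q.1
  · have : ∀ z : TorusSite 4 L, (z = p.1 - Pi.single μ 1 ∧ z = q.1 - Pi.single μ 1) ↔
        z = p.1 - Pi.single μ 1 := fun z => by rw [hpq, and_self]
    simp_rw [this, Finset.sum_ite_eq', Finset.mem_univ, if_true, hunit, Matrix.one_apply,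
      Prod.ext_iff, hpq, true_and]
  · have : ∀ z : TorusSite 4 L, ¬ (z = p.1 - Pi.single μ 1 ∧ z = q.1 - Pi.single μ 1) := by
      rintro z ⟨h1, h2⟩; exact hpq (sub_left_inj.mp (h1.symm.trans h2))
    simp_rw [if_neg (this _), Finset.sum_const_zero, Matrix.one_apply, Prod.ext_iff, hpq,
      false_and, if_false]

/-- `F_μ F_μᴴ = 1`. [folklore] -/
theorem linkHop_mul_conjTranspose (hρ : ∀ g, ρ g ∈ Matrix.unitaryGroup (Fin N) ℂ)
    (U : GaugeConfig 4 L G) (μ : Fin 4) : linkHop ρ U μ * (linkHop ρ U μ)ᴴ = 1 := by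
  ext p q
  rw [Matrix.mul_apply, Fintype.sum_prod_type]
  simp only [conjTranspose_apply, linkHop, Matrix.of_apply]
  simp only [star_ite_zero, ite_zero_mul_ite_zero]
  simp_rw [Finset.sum_ite_irrel, Finset.sum_const_zero]
  have hunit : ∑ c : Fin N, ρ (U (p.1, μ)) p.2 c * star (ρ (U (p.1, μ)) q.2 c) =
      (1 : Matrix (Fin N) (Fin N) ℂ) p.2 q.2 := by
    rw [← Matrix.mem_unitaryGroup_iff.mp (hρ (U (p.1, μ))), Matrix.mul_apply]
    rfl
  by_cases hpq : p.1 = q.1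
  · have : ∀ z : TorusSite 4 L, (z = Site.shift p.1 μ ∧ z = Site.shift q.1 μ) ↔
        z = Site.shift p.1 μ := fun z => by rw [hpq, and_self]
    simp_rw [this, Finset.sum_ite_eq', Finset.mem_univ, if_true, ← hpq, hunit, Matrix.one_apply,
      Prod.ext_iff, hpq, true_and]
  · have : ∀ z : TorusSite 4 L, ¬ (z = Site.shift p.1 μ ∧ z = Site.shift q.1 μ) := by
      rintro z ⟨h1, h2⟩
      exact hpq (by simpa [Site.shift] using h1.symm.trans h2)
    simp_rw [if_neg (this _), Finset.sum_const_zero, Matrix.one_apply, Prod.ext_iff, hpq,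
      false_and, if_false]

/-- The Wilson hopping matrix in direction `μ` (`r = 1`):
`W_μ = F_μ ⊗ ½(1 − γ_μ) + F_μᴴ ⊗ ½(1 + γ_μ)` on (site ⊗ colour) ⊗ spin, reindexed to
site × colour × spin. [cite: HernandezJansenLuscher1999, (2.13)] -/
def wilsonHop (U : GaugeConfig 4 L G) (μ : Fin 4) :
    Matrix (TorusSite 4 L × Fin N × Fin 4) (TorusSite 4 L × Fin N × Fin 4) ℂ :=
  Matrix.reindex (Equiv.prodAssoc _ _ _) (Equiv.prodAssoc _ _ _)
    (linkHop ρ U μ ⊗ₖ chiralProjMinus μ + (linkHop ρ U μ)ᴴ ⊗ₖ chiralProjPlus μ)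

/-- **Each hopping matrix is an isometry**: `W_μᴴ W_μ = 1`. [folklore] -/
theorem conjTranspose_mul_wilsonHop (hρ : ∀ g, ρ g ∈ Matrix.unitaryGroup (Fin N) ℂ)
    (U : GaugeConfig 4 L G) (μ : Fin 4) : (wilsonHop ρ U μ)ᴴ * wilsonHop ρ U μ = 1 := by
  have h1 := conjTranspose_mul_linkHop ρ hρ U μ
  have h2 := linkHop_mul_conjTranspose ρ hρ U μ
  rw [wilsonHop, Matrix.reindex_apply, Matrix.conjTranspose_submatrix, Matrix.submatrix_mul_equiv,
    conjTranspose_add, conjTranspose_kronecker, conjTranspose_kronecker,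
    conjTranspose_conjTranspose, chiralProjMinus_conjTranspose, chiralProjPlus_conjTranspose,
    add_mul, mul_add, mul_add, ← mul_kronecker_mul, ← mul_kronecker_mul, ← mul_kronecker_mul,
    ← mul_kronecker_mul, h1, h2, chiralProjMinus_mul_self, chiralProjMinus_mul_chiralProjPlus,
    chiralProjPlus_mul_chiralProjMinus, chiralProjPlus_mul_self, kronecker_zero, kronecker_zero,
    add_zero, zero_add, ← kronecker_add, chiralProjMinus_add_chiralProjPlus, one_kronecker_one,
    submatrix_one_equiv]

omit [NeZero L] in
/-- **The Wilson operator as mass term minus hopping terms**: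
`wilsonDirac ρ U m 1 = (m + 4)·1 − Σ_μ W_μ` for unitary `ρ`.
[cite: HernandezJansenLuscher1999, (2.13)] -/
theorem wilsonDirac_eq_sub_sum_wilsonHop (hρ : ∀ g, ρ g ∈ Matrix.unitaryGroup (Fin N) ℂ)
    (U : GaugeConfig 4 L G) (m : ℝ) :
    wilsonDirac ρ U m 1 =
      ((m + 4 : ℝ) : ℂ) • (1 : Matrix _ _ ℂ) - ∑ μ, wilsonHop ρ U μ := by
  ext p q
  simp only [wilsonDirac, wilsonHop, linkHop, chiralProjMinus, chiralProjPlus,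
    ← star_rep_eq_rep_inv ρ hρ, Matrix.star_apply,
    Matrix.of_apply, Matrix.sub_apply, Matrix.smul_apply, Matrix.sum_apply, Matrix.reindex_apply,
    Matrix.submatrix_apply, Equiv.prodAssoc_symm_apply, Matrix.add_apply,
    Matrix.kroneckerMap_apply, conjTranspose_apply, Matrix.one_apply, smul_eq_mul]
  simp only [star_ite_zero, Finset.mul_sum]
  congr 1
  · split_ifs <;> push_cast <;> ring
  · refine Finset.sum_congr rfl fun μ _ => ?_
    simp only [Complex.ofReal_one]
    split_ifs <;> ring

open scoped Matrix.Norms.L2Operator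

/-- `‖W_μ‖ ≤ 1` in the `ℓ²` operator norm. [folklore] -/
theorem l2_opNorm_wilsonHop_le (hρ : ∀ g, ρ g ∈ Matrix.unitaryGroup (Fin N) ℂ)
    (U : GaugeConfig 4 L G) (μ : Fin 4) : ‖wilsonHop ρ U μ‖ ≤ 1 := by
  have hone : ‖(1 : Matrix (TorusSite 4 L × Fin N × Fin 4) (TorusSite 4 L × Fin N × Fin 4) ℂ)‖
      ≤ 1 := by
    rw [Matrix.cstar_norm_def, map_one]
    exact ContinuousLinearMap.norm_id_le
  have hsq : ‖wilsonHop ρ U μ‖ * ‖wilsonHop ρ U μ‖ ≤ 1 := by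
    rw [← CStarRing.norm_star_mul_self, star_eq_conjTranspose, conjTranspose_mul_wilsonHop ρ hρ]
    exact hone
  nlinarith [norm_nonneg (wilsonHop ρ U μ)]

/-- **HJL (2.14), general mass**: `‖wilsonDirac ρ U m 1‖ ≤ |m + 4| + 4` in the `ℓ²` operator norm,
for unitary `ρ`, every periodic lattice and every gauge field.
[cite: HernandezJansenLuscher1999, (2.14)] -/
theorem l2_opNorm_wilsonDirac_le (hρ : ∀ g, ρ g ∈ Matrix.unitaryGroup (Fin N) ℂ)
    (U : GaugeConfig 4 L G) (m : ℝ) : ‖wilsonDirac ρ U m 1‖ ≤ |m + 4| + 4 := by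
  have hone : ‖(1 : Matrix (TorusSite 4 L × Fin N × Fin 4) (TorusSite 4 L × Fin N × Fin 4) ℂ)‖
      ≤ 1 := by
    rw [Matrix.cstar_norm_def, map_one]
    exact ContinuousLinearMap.norm_id_le
  rw [wilsonDirac_eq_sub_sum_wilsonHop ρ hρ U m]
  refine (norm_sub_le _ _).trans (add_le_add ?_ ?_)
  · rw [norm_smul, Complex.norm_real, Real.norm_eq_abs]
    calc |m + 4| * ‖(1 : Matrix _ _ ℂ)‖ ≤ |m + 4| * 1 := by gcongr
      _ = |m + 4| := mul_one _
  · calc ‖∑ μ : Fin 4, wilsonHop ρ U μ‖ ≤ ∑ μ : Fin 4, ‖wilsonHop ρ U μ‖ := norm_sum_le _ _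
      _ ≤ ∑ _μ : Fin 4, (1 : ℝ) := Finset.sum_le_sum fun μ _ => l2_opNorm_wilsonHop_le ρ hρ U μ
      _ = 4 := by simp

/-- **HJL (2.14) as printed**: `‖A‖ = ‖1 + s − D_w‖ ≤ 8` for `|s| < 1`, i.e.
`‖wilsonDirac ρ U m 1‖ ≤ 8` for `m = −(1+s) ∈ (−2, 0)`.
[cite: HernandezJansenLuscher1999, (2.14)] -/
theorem l2_opNorm_wilsonDirac_le_eight (hρ : ∀ g, ρ g ∈ Matrix.unitaryGroup (Fin N) ℂ)
    (U : GaugeConfig 4 L G) {m : ℝ} (hm₁ : -2 < m) (hm₂ : m < 0) : ‖wilsonDirac ρ U m 1‖ ≤ 8 := by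
  refine (l2_opNorm_wilsonDirac_le ρ hρ U m).trans ?_
  rw [abs_of_pos (by linarith)]
  linarith

/-- The operator-norm bound in quadratic-form language: `Σ_i ‖(D_W ψ)_i‖² ≤ ‖D_W‖² Σ_i ‖ψ_i‖²`.
[folklore] -/
theorem sum_norm_sq_mulVec_le (M : Matrix (TorusSite 4 L × Fin N × Fin 4)
    (TorusSite 4 L × Fin N × Fin 4) ℂ) (ψ : TorusSite 4 L × Fin N × Fin 4 → ℂ) :
    ∑ i, ‖(M *ᵥ ψ) i‖ ^ 2 ≤ ‖M‖ ^ 2 * ∑ i, ‖ψ i‖ ^ 2 := by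
  set e := EuclideanSpace.equiv (TorusSite 4 L × Fin N × Fin 4) ℂ
  have hψ : ∑ i, ‖ψ i‖ ^ 2 = ‖e.symm ψ‖ ^ 2 := by
    rw [EuclideanSpace.norm_sq_eq]; rfl
  have hMψ : ∑ i, ‖(M *ᵥ ψ) i‖ ^ 2 = ‖e.symm (M *ᵥ ⇑(e.symm ψ))‖ ^ 2 := by
    rw [EuclideanSpace.norm_sq_eq]; rfl
  rw [hψ, hMψ, ← mul_pow]
  exact pow_le_pow_left₀ (norm_nonneg _) (Matrix.l2_opNorm_mulVec M _) 2

/-- **Upper spectral bound `A†A ≤ 64`** ((2.14) squared, quadratic-form version at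
`m ∈ (−2, 0)`). [cite: HernandezJansenLuscher1999, (2.14)] -/
theorem sum_norm_sq_wilsonDirac_mulVec_le (hρ : ∀ g, ρ g ∈ Matrix.unitaryGroup (Fin N) ℂ)
    (U : GaugeConfig 4 L G) {m : ℝ} (hm₁ : -2 < m) (hm₂ : m < 0)
    (ψ : TorusSite 4 L × Fin N × Fin 4 → ℂ) :
    ∑ i, ‖(wilsonDirac ρ U m 1 *ᵥ ψ) i‖ ^ 2 ≤ 64 * ∑ i, ‖ψ i‖ ^ 2 := by
  refine (sum_norm_sq_mulVec_le _ ψ).trans ?_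
  have h8 := l2_opNorm_wilsonDirac_le_eight ρ hρ U hm₁ hm₂
  have h0 : 0 ≤ ∑ i, ‖ψ i‖ ^ 2 := Finset.sum_nonneg fun i _ => by positivity
  have : ‖wilsonDirac ρ U m 1‖ ^ 2 ≤ 64 := by nlinarith [norm_nonneg (wilsonDirac ρ U m 1)]
  exact mul_le_mul_of_nonneg_right this h0

end NormBound

/-! ### The packaged consequence used by the route -/

section Consequences

variable {ρ : G →* Matrix (Fin N) (Fin N) ℂ}

open scoped Matrix.Norms.L2Operator in
/-- Admissibility forces `ε ≥ 0` (plaquettes exist on every periodic lattice). [folklore] -/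
theorem IsNormAdmissible.nonneg [NeZero L] {U : GaugeConfig 4 L G} {ε : ℝ}
    (hU : IsNormAdmissible ρ U ε) : 0 ≤ ε := by
  have h := hU ((0 : TorusSite 4 L), ⟨((0 : Fin 4), (1 : Fin 4)), by decide⟩)
  exact (norm_nonneg _).trans h

open scoped Matrix.Norms.L2Operator in
/-- **HJL locality under admissibility, packaged** (§2.3 + §2.5): from the named fact, for a
unitary `ρ`, an admissible field with `ε < 1/30` and `s = 0`, the kernel of `(A†A)^{-1/2}` obeys
(2.12) with the uniform constants `u = 1 − 30ε` (2.16) and `v = 64` ((2.14), proved above):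
`‖G(x,y)‖ ≤ κ/(1−t) · exp(−θ‖x−y‖₁/2)` on every periodic lattice — "the localization range is
uniformly bounded from above by a constant depending on `ε` only".
[cite: HernandezJansenLuscher1999, §2.3 and §2.5] -/
theorem HJLLocality.locality_of_admissible (h : HJLLocality ρ)
    (hρ : ∀ g, ρ g ∈ Matrix.unitaryGroup (Fin N) ℂ) [NeZero L] (U : GaugeConfig 4 L G) {ε : ℝ}
    (hε : ε < 1 / 30) (hU : IsNormAdmissible ρ U ε) (x y : TorusSite 4 L) :
    ‖siteBlock (cfc (fun s : ℝ => (Real.sqrt s)⁻¹)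
        ((wilsonDirac ρ U (-1) 1)ᴴ * wilsonDirac ρ U (-1) 1)) x y‖ ≤
      hjlKappa (1 - 30 * ε) 64 / (1 - hjlT (1 - 30 * ε) 64) *
        Real.exp (-(hjlTheta (1 - 30 * ε) 64 * torusTaxiDist x y / 2)) := by
  have hε0 := hU.nonneg
  exact h.2 hρ U (-1) (1 - 30 * ε) 64 (by norm_num) (by norm_num) (by linarith) (by linarith)
    (h.1 hρ U ε hU) (sum_norm_sq_wilsonDirac_mulVec_le ρ hρ U (by norm_num) (by norm_num)) x y

open scoped Matrix.Norms.L2Operator in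
/-- **The same bound in closed form**: for an admissible field with `ε < 1/30`,
`‖G(x,y)‖ ≤ (1 − 30ε)^{−1/2} · ((8 − √(1−30ε))/(8 + √(1−30ε)))^{‖x−y‖₁/2}`.
[cite: HernandezJansenLuscher1999, (2.12) with (2.14), (2.16)] -/
theorem HJLLocality.locality_of_admissible_closedForm (h : HJLLocality ρ)
    (hρ : ∀ g, ρ g ∈ Matrix.unitaryGroup (Fin N) ℂ) [NeZero L] (U : GaugeConfig 4 L G) {ε : ℝ}
    (hε : ε < 1 / 30) (hU : IsNormAdmissible ρ U ε) (x y : TorusSite 4 L) :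
    ‖siteBlock (cfc (fun s : ℝ => (Real.sqrt s)⁻¹)
        ((wilsonDirac ρ U (-1) 1)ᴴ * wilsonDirac ρ U (-1) 1)) x y‖ ≤
      (Real.sqrt (1 - 30 * ε))⁻¹ *
        ((8 - Real.sqrt (1 - 30 * ε)) / (8 + Real.sqrt (1 - 30 * ε))) ^
          ((torusTaxiDist x y : ℝ) / 2) := by
  have hu : 0 < 1 - 30 * ε := by linarith
  have huv : 1 - 30 * ε < 64 := by linarith [hU.nonneg]
  have h1 := h.locality_of_admissible hρ U hε hU x y
  rw [hjlKappa_div_one_sub_hjlT hu huv, exp_neg_hjlTheta_mul, hjlT_eq hu huv,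
    show Real.sqrt 64 = 8 by rw [show (64 : ℝ) = 8 ^ 2 by norm_num, Real.sqrt_sq (by norm_num)]]
    at h1
  exact h1

end Consequences

end Literature.MathematicalPhysics.QuantumLattice
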